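import Summits.ResolutionOfSingularities.ResolutionOfSingularities.Theorems.ShallowPort4

/-!
# ShallowPort5 — stage zero, part 2: `nonempty_zeroFrame` (§9b)

Stage `0` of a ROOTED forced tower (`Rooted T k p F`: `X_0 ≅ 𝔸⁴_k`, `D 0 = ((Z^p + F), ∅, p)`) with `IsDatum p` (the `IsBase`
binder `_hB` is kept for the callers' positional signature but is not needed here) carries Cossart–Piltant's frame: `F` is
not a `p`-th power by ISOLATION of `x_0` in the top locus (else `Z^p + F = (Z + G)^p`
and the top locus contains `{Z + G = 0}`), hence `Z^p + F` is irreducible over `k(u)`, `L = k(u)[Z]/(Z^p + F)` is a field,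
`R ≅ k[u]_𝔫` (`𝔫 = 𝔮_{x_0} ∩ k[u]`) is regular local, excellent, of dimension `3`, residue characteristic `p`; (MIN)/(GEN)/case (i)
hold (tree `eq_zero_of_natDegree_lt_of_irreducible`, `exists_mul_algebraMap_eq_aeval_of_adjoin_eq_top`); `φ₀` = evaluation
at the root, localised at `x_0`, kills exactly `(Z^p + F)·𝒪_{X_0,x_0}`.

References: CP 2019 Thm. 1.5, Def. 2.3 [CossartPiltant2019]. AI-written; weaker than expert review.
(decomp-res lens-5 g38, critic ROW 232 (M-Shallow); host route `MaxContactCut`, item stmt-ResolutionOfSingularities-31768 `PolyPureTowersShallow`;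
source of truth: the farm-checked monolith `ShallowPortNode.lean`, of which this is land slice 5/6 — slices land sequentially, slice k imports slice k-1.)
-/

noncomputable section

set_option linter.dupNamespace false

open IsLocalRing IsLocalization
open Literature.RingTheory.HilbertSamuel Literature.AlgebraicGeometry.Resolution
open Summit.ResolutionOfSingularities.ResolutionOfSingularities.Theorems.SigmaMaxModificationsCorridor3.Helpers
open Summit.ResolutionOfSingularities.ResolutionOfSingularities.Theorems.SwitchingDichotomy.SteeredRun

universe u

namespace Summit.ResolutionOfSingularities.ResolutionOfSingularities.Theorems.ShallowPort

/-! ## §9 (continued) Stage zero carries Cossart–Piltant's frame -/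

section StageZeroFrame

open CategoryTheory AlgebraicGeometry TopologicalSpace Topology Polynomial
open Scheme.IdealSheafData
open Summit.ResolutionOfSingularities.ResolutionOfSingularities.Theorems.ForcedTowerClasses
open Summit.ResolutionOfSingularities.ResolutionOfSingularities.Theorems.HugValuationCut
open Summit.ResolutionOfSingularities.ResolutionOfSingularities.Theorems.TightDefectClasses

variable {k : Type} [Field k] {p : ℕ}

set_option maxHeartbeats 4000000 in
/-- **Stage zero of a rooted forced tower carries Cossart–Piltant's frame.**  From `Rooted T k p F` (stage `0` is `𝔸⁴_k`
with `D 0 = ((Z^p + F), ∅, p)`), `IsDatum p` and the isolation of `x_0` in the top locus: `F` is not a `p`-th power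
(else `Z^p + F = (Z + G)^p` and the top locus contains the hypersurface `Z + G = 0` through `x_0`), so `Z^p + F` is irreducible
over `k(u)` and `L = k(u)[Z]/(Z^p + F)` is a field; `φ₀` is evaluation at the root, localised at `x_0`.
[cite: CossartPiltant2019, Thm. 1.5, Def. 2.3] [cite: Hauser2010, §F] -/
theorem nonempty_zeroFrame (hp : p.Prime) [CharP k p] (F : Base k) (T : ForcedTower) (g : T.St 0 ⟶ Spec (.of k))
    (_hB : IsBase (T.St 0) g) (hD : IsDatum p (T.D 0)) (hroot : Rooted T k p F) : Nonempty (ZeroFrame T p) := by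
  classical
  haveI hpf : Fact p.Prime := ⟨hp⟩
  obtain ⟨ι, hι⟩ := hroot
  -- (A) stage `0` is affine; the stalk at `x_0` is `Γ(X_0)_𝔮`
  haveI : IsAffine (T.St 0) := IsAffine.of_isIso ι.inv
  have hU : IsAffineOpen (⊤ : (T.St 0).Opens) := isAffineOpen_top (T.St 0)
  letI alg := (T.St 0).presheaf.algebra_section_stalk (⟨T.pt 0, trivial⟩ : (⊤ : (T.St 0).Opens))
  haveI hlocst : IsLocalization.AtPrime ((T.St 0).presheaf.stalk (T.pt 0))
      (hU.primeIdealOf ⟨T.pt 0, trivial⟩).asIdeal := hU.isLocalization_stalk ⟨T.pt 0, trivial⟩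
  have hqmax : (hU.primeIdealOf ⟨T.pt 0, trivial⟩).asIdeal.IsMaximal :=
    hU.primeIdealOf_isMaximal_of_isClosed ⟨T.pt 0, trivial⟩ (T.isClosed_pt 0)
  generalize hy₀ : hU.primeIdealOf ⟨T.pt 0, trivial⟩ = y₀ at hlocst hqmax
  -- (B) `Γ(X_0) ≅ k[u][Z]`, `H = Z^p + F`, `D 0 = (H)·𝒪`
  let eΓ : CommRingCat.of (Polynomial (Base k)) ≅ Γ(T.St 0, ⊤) :=
    (Scheme.ΓSpecIso (CommRingCat.of (Polynomial (Base k)))).symm ≪≫ Scheme.Γ.mapIso ι.symm.op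
  let eψ : Polynomial (Base k) ≃+* Γ(T.St 0, ⊤) := eΓ.commRingCatIsoToRingEquiv
  have heψ : ∀ a, eψ a = ι.inv.appTop.hom ((Scheme.ΓSpecIso (CommRingCat.of (Polynomial (Base k)))).inv.hom a) :=
    fun a => rfl
  set h₀ : Polynomial (Base k) := X ^ p + C F with hh₀
  have hmon₀ : h₀.Monic := monic_X_pow_add_C F hp.ne_zero
  have hdeg₀ : h₀.natDegree = p := natDegree_X_pow_add_C
  have h₀1 : h₀ ≠ 1 := fun h => hp.ne_zero (by rw [← hdeg₀, h, natDegree_one])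
  have hideal : (T.D 0).ideal = ofIdealTop (Ideal.span {eψ h₀}) := by
    have h1 : (T.D 0).ideal = ((T.D 0).ideal.comap ι.hom).comap ι.inv := by
      rw [← Scheme.IdealSheafData.comap_comp, Iso.inv_hom_id, Scheme.IdealSheafData.comap_id]
    have h2 : (T.D 0).ideal.comap ι.hom = pureIdeal k p F := by
      have := congrArg MarkedIdeal.ideal hι
      rwa [MarkedIdeal.comap_ideal] at this
    rw [h1, h2, pureIdeal, comap_ofIdealTop_of_isAffine, Ideal.map_span, Set.image_singleton, heψ, ← hh₀]
  have hstalk : stalkIdeal (T.D 0).ideal (T.pt 0) =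
      Ideal.span {algebraMap Γ(T.St 0, ⊤) ((T.St 0).presheaf.stalk (T.pt 0)) (eψ h₀)} := by
    rw [hideal, stalkIdeal_eq_map_germ _ ⟨⊤, hU⟩ (trivial : T.pt 0 ∈ (⊤ : (T.St 0).Opens)),
      ideal_ofIdealTop_top, Ideal.map_span, Set.image_singleton]
    rfl
  -- (C) `H ∈ y₀.asIdeal`
  have hHq : eψ h₀ ∈ y₀.asIdeal := by
    rw [← IsLocalization.AtPrime.to_map_mem_maximal_iff ((T.St 0).presheaf.stalk (T.pt 0)) y₀.asIdeal (eψ h₀)]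
    have hle := tower_stalkIdeal_le_pow T hD 0
    rw [hstalk] at hle
    exact Ideal.pow_le_self hp.ne_zero ((Ideal.span_singleton_le_iff_mem _).mp hle)
  -- (D) `𝔫 = y₀.asIdeal ∩ k[u]` is maximal; `S = k[u]_𝔫` is regular local, excellent, of dimension three
  obtain ⟨𝔫, h𝔫def⟩ : ∃ 𝔫 : Ideal (Base k), 𝔫 = (y₀.asIdeal.comap eψ).comap (C : Base k →+* Polynomial (Base k)) := ⟨_, rfl⟩
  haveI h𝔫 : 𝔫.IsMaximal := by
    haveI : (y₀.asIdeal.comap eψ).IsMaximal := Ideal.comap_isMaximal_of_surjective eψ eψ.surjective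
    rw [h𝔫def]
    exact Polynomial.isMaximal_comap_C_of_isJacobsonRing _
  have hmem𝔫 : ∀ a : Base k, a ∈ 𝔫 ↔ eψ (C a) ∈ y₀.asIdeal := fun a => by rw [h𝔫def, Ideal.mem_comap, Ideal.mem_comap]
  have hPS : Function.Injective (algebraMap (Base k) (Localization.AtPrime 𝔫)) :=
    IsLocalization.injective (Localization.AtPrime 𝔫) 𝔫.primeCompl_le_nonZeroDivisors
  have hexcS : IsExcellentRing (Localization.AtPrime 𝔫) :=
    IsExcellentRing.of_isLocalization 𝔫.primeCompl (isExcellentRing_of_finiteType_field k (Base k))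
  have hdimS : ringKrullDim (Localization.AtPrime 𝔫) = 3 := by
    rw [IsLocalization.AtPrime.ringKrullDim_eq_height 𝔫 (Localization.AtPrime 𝔫)]
    have h := Literature.RingTheory.KrullDimension.ringKrullDim_quotient_add_height k 𝔫
    rw [ringKrullDim_eq_zero_of_isField ((Ideal.Quotient.maximal_ideal_iff_isField_quotient 𝔫).mp inferInstance),
      zero_add, MvPolynomial.ringKrullDim_of_isNoetherianRing] at h
    rw [h]
    simp
  have hcharS : CharP (ResidueField (Localization.AtPrime 𝔫)) p :=
    (RingHom.charP_iff_charP ((IsLocalRing.residue (Localization.AtPrime 𝔫)).comp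
      (algebraMap k (Localization.AtPrime 𝔫))) p).mp inferInstance
  -- (E) `F` is not a `p`-th power: else `H = (Z + G)^p` and the top locus contains `{Z + G = 0} ∋ x_0`, against isolation
  have hnotpow : ∀ G : Base k, F ≠ G ^ p := by
    intro G hFG
    have hℓp : eψ h₀ = (eψ (X + C G)) ^ p := by
      rw [← map_pow, hh₀, hFG, C_pow, ← add_pow_char]
    have hℓq : eψ (X + C G) ∈ y₀.asIdeal := hqmax.isPrime.mem_of_pow_mem p (hℓp ▸ hHq)
    have hXC : (X + C G : Polynomial (Base k)) = X - C (-G) := by rw [map_neg, sub_neg_eq_add]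
    haveI h𝔭A : (Ideal.span {X + C G} : Ideal (Polynomial (Base k))).IsPrime := by
      rw [hXC, ← Polynomial.ker_evalRingHom]
      exact RingHom.ker_isPrime _
    have h𝔭A' : ¬ (Ideal.span {X + C G} : Ideal (Polynomial (Base k))).IsMaximal := by
      intro hmax
      rw [hXC, ← Polynomial.ker_evalRingHom] at hmax
      have hfield := (Ideal.Quotient.maximal_ideal_iff_isField_quotient _).mp hmax
      have hsurj : Function.Surjective (evalRingHom (-G) : Polynomial (Base k) →+* Base k) :=
        fun a => ⟨C a, eval_C⟩
      have hF3 : IsField (Base k) :=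
        MulEquiv.isField hfield (RingHom.quotientKerEquivOfSurjective hsurj).symm.toMulEquiv
      have hdim3 : ringKrullDim (Base k) = 3 := by
        rw [MvPolynomial.ringKrullDim_of_isNoetherianRing, ringKrullDim_eq_zero_of_field]
        simp
      rw [ringKrullDim_eq_zero_of_isField hF3] at hdim3
      exact absurd hdim3 (by simp)
    have h𝔭Γ : ((Ideal.span {X + C G}).map eψ : Ideal Γ(T.St 0, ⊤)) = Ideal.span {eψ (X + C G)} := by
      rw [Ideal.map_span, Set.image_singleton]
    have h𝔭Γp : (Ideal.span {eψ (X + C G)} : Ideal Γ(T.St 0, ⊤)).IsPrime :=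
      h𝔭Γ ▸ Ideal.map_isPrime_of_equiv eψ
    have h𝔭Γm : ¬ (Ideal.span {eψ (X + C G)} : Ideal Γ(T.St 0, ⊤)).IsMaximal := by
      intro hm
      apply h𝔭A'
      have := Ideal.comap_isMaximal_of_surjective eψ eψ.surjective (K := Ideal.span {eψ (X + C G)})
      rwa [← h𝔭Γ, Ideal.comap_map_of_bijective eψ eψ.bijective] at this
    have h𝔭le : (Ideal.span {eψ (X + C G)} : Ideal Γ(T.St 0, ⊤)) ≤ y₀.asIdeal :=
      (Ideal.span_singleton_le_iff_mem _).mpr hℓq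
    have hdisj : Disjoint (y₀.asIdeal.primeCompl : Set Γ(T.St 0, ⊤)) (Ideal.span {eψ (X + C G)} : Ideal Γ(T.St 0, ⊤)) :=
      Set.disjoint_left.mpr fun s hs hs' => hs (h𝔭le hs')
    obtain ⟨P, hPdef⟩ : ∃ P : Ideal ((T.St 0).presheaf.stalk (T.pt 0)),
        P = (Ideal.span {eψ (X + C G)}).map (algebraMap Γ(T.St 0, ⊤) ((T.St 0).presheaf.stalk (T.pt 0))) := ⟨_, rfl⟩
    haveI hPp : P.IsPrime := by
      rw [hPdef]
      exact IsLocalization.isPrime_of_isPrime_disjoint y₀.asIdeal.primeCompl _ _ h𝔭Γp hdisj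
    have hPne : P ≠ maximalIdeal _ := by
      intro hP
      apply h𝔭Γm
      have hc := IsLocalization.under_map_of_isPrime_disjoint y₀.asIdeal.primeCompl ((T.St 0).presheaf.stalk (T.pt 0))
        h𝔭Γp hdisj
      rw [← hPdef, hP, IsLocalization.AtPrime.under_maximalIdeal ((T.St 0).presheaf.stalk (T.pt 0)) y₀.asIdeal] at hc
      rw [← hc]
      exact hqmax
    have hHP : algebraMap _ (Localization.AtPrime P)
        (algebraMap Γ(T.St 0, ⊤) ((T.St 0).presheaf.stalk (T.pt 0)) (eψ h₀)) ∈ maximalIdeal _ ^ p := by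
      rw [hℓp, map_pow, map_pow]
      refine Ideal.pow_mem_pow ?_ p
      rw [IsLocalization.AtPrime.to_map_mem_maximal_iff (Localization.AtPrime P) P, hPdef]
      exact Ideal.mem_map_of_mem _ (Ideal.mem_span_singleton_self _)
    obtain ⟨ζ, hζ, hζne, hord⟩ := exists_specializes_ne_le_idealOrder (T.D 0).ideal hstalk P hPne hHP
    obtain ⟨U, hxU, hUiso⟩ := tower_exists_isolating_open T hD 0
    exact hζne (hUiso ζ (hζ.mem_open U.2 hxU) hord)
  -- (F) `K = k(u)`, `L = K[Z]/(Z^p + F)`, the root `x`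
  have hirrK : Irreducible (X ^ p + C (algebraMap (Base k) (FractionRing (Base k)) F)) :=
    irreducible_X_pow_add_C_of_forall_ne_pow hp hnotpow
  obtain ⟨fK, hfK⟩ : ∃ fK : (FractionRing (Base k))[X],
      fK = X ^ p + C (algebraMap (Base k) (FractionRing (Base k)) F) := ⟨_, rfl⟩
  haveI : Fact (Irreducible fK) := ⟨hfK ▸ hirrK⟩
  obtain ⟨hS, hhS⟩ : ∃ hS : (Localization.AtPrime 𝔫)[X],
      hS = X ^ p + C (algebraMap (Base k) (Localization.AtPrime 𝔫) F) := ⟨_, rfl⟩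
  have hmapS : h₀.map (algebraMap (Base k) (Localization.AtPrime 𝔫)) = hS := by
    rw [hh₀, hhS, Polynomial.map_add, Polynomial.map_pow, map_X, map_C]
  have hSK : hS.map (algebraMap (Localization.AtPrime 𝔫) (FractionRing (Base k))) = fK := by
    rw [hhS, hfK, Polynomial.map_add, Polynomial.map_pow, map_X, map_C, ← IsScalarTower.algebraMap_apply]
  have hmonS : hS.Monic := hmapS ▸ hmon₀.map _
  have hdegS : hS.natDegree = p := by rw [← hmapS, hmon₀.natDegree_map, hdeg₀]
  have hxS : aeval (AdjoinRoot.root fK) hS = 0 := by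
    rw [← aeval_map_algebraMap (FractionRing (Base k)) (AdjoinRoot.root fK) hS, hSK, AdjoinRoot.aeval_eq,
      AdjoinRoot.mk_self]
  have hirrS : Irreducible (hS.map (algebraMap (Localization.AtPrime 𝔫) (FractionRing (Base k)))) := by
    rw [hSK]; exact hfK ▸ hirrK
  have hgenK : Algebra.adjoin (FractionRing (Base k)) ({AdjoinRoot.root fK} : Set (AdjoinRoot fK)) = ⊤ :=
    AdjoinRoot.adjoinRoot_eq_top
  -- (G) the root map `ψ : k[u][Z] → L` and `φ₀ : 𝒪_{X_0,x_0} → L`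
  let ψA : Polynomial (Base k) →+* AdjoinRoot fK :=
    (Polynomial.aeval (AdjoinRoot.root fK)).toRingHom.comp (mapRingHom (algebraMap (Base k) (Localization.AtPrime 𝔫)))
  have hψA : ∀ q, ψA q = aeval (AdjoinRoot.root fK) (q.map (algebraMap (Base k) (Localization.AtPrime 𝔫))) :=
    fun q => rfl
  have hkerA : RingHom.ker ψA = Ideal.span {h₀} :=
    ker_aeval_mapRingHom_eq_span (K := FractionRing (Base k)) hPS hmon₀ h₀1 (hmapS ▸ hirrS) (hmapS ▸ hxS)
  have hψAh₀ : ψA h₀ = 0 := by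
    rw [← RingHom.mem_ker, hkerA]; exact Ideal.mem_span_singleton_self _
  let ψΓ : Γ(T.St 0, ⊤) →+* AdjoinRoot fK := ψA.comp eψ.symm.toRingHom
  have hψΓ : ∀ a, ψΓ (eψ a) = ψA a := fun a => by
    change ψA (eψ.symm (eψ a)) = ψA a
    rw [eψ.symm_apply_apply]
  have hkerΓ : RingHom.ker ψΓ = Ideal.span {eψ h₀} := by
    ext s
    constructor
    · intro hs
      have hs' : eψ.symm s ∈ RingHom.ker ψA := hs
      rw [hkerA, Ideal.mem_span_singleton] at hs'
      obtain ⟨c, hc⟩ := hs'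
      rw [Ideal.mem_span_singleton]
      exact ⟨eψ c, by rw [← map_mul, ← hc, eψ.apply_symm_apply]⟩
    · intro hs
      rw [Ideal.mem_span_singleton] at hs
      obtain ⟨c, rfl⟩ := hs
      rw [RingHom.mem_ker, map_mul]
      change ψA (eψ.symm (eψ h₀)) * _ = 0
      rw [eψ.symm_apply_apply, hψAh₀, zero_mul]
  have hunit : ∀ s : y₀.asIdeal.primeCompl, IsUnit (ψΓ s) := by
    intro s
    rw [isUnit_iff_ne_zero]
    intro hs0
    have hs : (s : Γ(T.St 0, ⊤)) ∈ RingHom.ker ψΓ := hs0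
    rw [hkerΓ] at hs
    exact s.2 ((Ideal.span_singleton_le_iff_mem _).mpr hHq hs)
  let φ₀ : (T.St 0).presheaf.stalk (T.pt 0) →+* AdjoinRoot fK := IsLocalization.lift (M := y₀.asIdeal.primeCompl) hunit
  have hφ₀a : ∀ s, φ₀ (algebraMap Γ(T.St 0, ⊤) _ s) = ψΓ s := fun s => IsLocalization.lift_eq hunit s
  have hkerφ₀ : RingHom.ker φ₀ = stalkIdeal (T.D 0).ideal (T.pt 0) := by
    rw [hstalk, show RingHom.ker φ₀ = _ from ker_lift_eq_map_ker hunit, hkerΓ, Ideal.map_span, Set.image_singleton]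
  let S₀ : Stage T (AdjoinRoot fK) 0 := ⟨φ₀, hkerφ₀, ⟨⟨_, hstalk⟩⟩⟩
  -- `φ₀(a/t) = alg(a/t)` for `a, t ∈ k[u]`, `t ∉ 𝔫`
  have ht𝔮 : ∀ t : Base k, t ∉ 𝔫 → eψ (C t) ∈ y₀.asIdeal.primeCompl := fun t ht h => ht ((hmem𝔫 t).mpr h)
  have hmk : ∀ (a t : Base k) (ht : t ∉ 𝔫),
      φ₀ (IsLocalization.mk' _ (eψ (C a)) ⟨eψ (C t), ht𝔮 t ht⟩) =
        algebraMap (Localization.AtPrime 𝔫) (AdjoinRoot fK)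
          (IsLocalization.mk' (Localization.AtPrime 𝔫) a (⟨t, ht⟩ : 𝔫.primeCompl)) := by
    intro a t ht
    change IsLocalization.lift hunit _ = _
    rw [IsLocalization.lift_mk'_spec]
    change ψΓ (eψ (C a)) = ψΓ (eψ (C t)) * _
    rw [hψΓ, hψΓ, hψA, hψA, map_C, map_C, aeval_C, aeval_C, ← map_mul,
      IsLocalization.mk'_spec'_mk (Localization.AtPrime 𝔫) a t ht]
  -- (H) `R = im(S → L) ≅ S` and the transported equation (pattern of `CossartPiltant2019Local.of_inField`)
  have hinj : Function.Injective (algebraMap (Localization.AtPrime 𝔫) (AdjoinRoot fK)) := by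
    rw [IsScalarTower.algebraMap_eq (Localization.AtPrime 𝔫) (FractionRing (Base k)) (AdjoinRoot fK)]
    exact (algebraMap (FractionRing (Base k)) (AdjoinRoot fK)).injective.comp
      (IsFractionRing.injective (Localization.AtPrime 𝔫) (FractionRing (Base k)))
  set R : Subring (AdjoinRoot fK) := (algebraMap (Localization.AtPrime 𝔫) (AdjoinRoot fK)).range with hRdef
  set f : Localization.AtPrime 𝔫 →+* R := (algebraMap (Localization.AtPrime 𝔫) (AdjoinRoot fK)).rangeRestrict with hf
  have hfbij : Function.Bijective f :=
    ⟨fun a b hab => hinj (congrArg Subtype.val hab), RingHom.rangeRestrict_surjective _⟩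
  let e : Localization.AtPrime 𝔫 ≃+* R := RingEquiv.ofBijective f hfbij
  have he : ∀ s, ((e s : R) : AdjoinRoot fK) = algebraMap (Localization.AtPrime 𝔫) (AdjoinRoot fK) s := fun _ => rfl
  haveI : IsRegularLocalRing R := IsRegularLocalRing.of_ringEquiv e
  have hexcR : IsExcellentRing R := hexcS.of_ringEquiv e
  have hdimR : ringKrullDim R = 3 := by rw [← ringKrullDim_eq_of_ringEquiv e, hdimS]
  haveI hloc : IsLocalHom e.toRingHom := ⟨fun a ha => by simpa using ha.map e.symm.toRingHom⟩
  have hcharR : CharP (ResidueField R) p := (RingHom.charP_iff_charP (ResidueField.map e.toRingHom) p).mp hcharS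
  set h' : R[X] := hS.map f with hh'
  have hmon' : h'.Monic := hmonS.map f
  have hdeg' : h'.natDegree = p := by rw [hh', hmonS.natDegree_map, hdegS]
  have haeval : ∀ q : (Localization.AtPrime 𝔫)[X], aeval (AdjoinRoot.root fK) (q.map f) = aeval (AdjoinRoot.root fK) q :=
    fun q => aeval_map_rangeRestrict q _
  have hx' : aeval (AdjoinRoot.root fK) h' = 0 := by rw [hh', haeval, hxS]
  have hmin : ∀ q : R[X], q.natDegree < p → aeval (AdjoinRoot.root fK) q = 0 → q = 0 := by
    intro q hqdeg hq
    set q₀ : (Localization.AtPrime 𝔫)[X] := q.map e.symm.toRingHom with hq₀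
    have hqq₀ : q₀.map f = q := by
      rw [hq₀, Polynomial.map_map]
      ext i
      rw [coeff_map]
      exact congrArg Subtype.val (e.apply_symm_apply (q.coeff i))
    have hq₀x : aeval (AdjoinRoot.root fK) q₀ = 0 := by rw [← haeval, hqq₀, hq]
    have hq₀deg : q₀.natDegree < hS.natDegree := by
      have hdd : q₀.natDegree = q.natDegree := by rw [← hqq₀, natDegree_map_eq_of_injective hfbij.1]
      rw [hdd, hdegS]
      exact hqdeg
    have := eq_zero_of_natDegree_lt_of_irreducible (K := FractionRing (Base k)) hmonS hirrS hxS hq₀deg hq₀x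
    rw [← hqq₀, this, Polynomial.map_zero]
  have hgen' : ∀ z : AdjoinRoot fK, ∃ (q : R[X]) (s : R), s ≠ 0 ∧ z * s = aeval (AdjoinRoot.root fK) q := by
    intro z
    obtain ⟨q, s, hs, hz⟩ := exists_mul_algebraMap_eq_aeval_of_adjoin_eq_top (S := Localization.AtPrime 𝔫)
      (K := FractionRing (Base k)) hgenK z
    refine ⟨q.map f, e s, fun h0 => hs (e.injective (by rw [h0, map_zero])), ?_⟩
    rw [haeval, he, hz]
  have hcase' : CharP (AdjoinRoot fK) p ∧ ∀ i, 0 < i → i < p → h'.coeff i = 0 := by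
    refine ⟨?_, fun i hi0 hip => ?_⟩
    · haveI : CharP (FractionRing (Base k)) p :=
        charP_of_injective_algebraMap (IsFractionRing.injective (Base k) (FractionRing (Base k))) p
      exact charP_of_injective_ringHom (algebraMap (FractionRing (Base k)) (AdjoinRoot fK)).injective p
    · rw [hh', coeff_map, hhS, coeff_add, coeff_X_pow, coeff_C, if_neg (ne_of_lt hip), if_neg hi0.ne', add_zero,
        map_zero]
  -- (I) `R ⊆ φ₀(𝒪)`, domination, `R[x] ⊆ φ₀(𝒪)`, fractions
  have hRB : R ≤ φ₀.range := by
    rintro _ ⟨s, rfl⟩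
    obtain ⟨⟨a, t⟩, rfl⟩ := IsLocalization.mk'_surjective 𝔫.primeCompl s
    exact ⟨_, hmk a t t.2⟩
  have hinv : ∀ r : R, r ∈ maximalIdeal R → (r : AdjoinRoot fK) ≠ 0 → (r : AdjoinRoot fK)⁻¹ ∉ φ₀.range := by
    intro r hr hr0 hrinv
    obtain ⟨s, rfl⟩ := e.surjective r
    have hs : s ∈ maximalIdeal (Localization.AtPrime 𝔫) := (map_mem_nonunits_iff e.toRingHom s).mp hr
    obtain ⟨⟨a, t⟩, rfl⟩ := IsLocalization.mk'_surjective 𝔫.primeCompl s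
    have ha : a ∈ 𝔫 := (IsLocalization.AtPrime.mk'_mem_maximal_iff (Localization.AtPrime 𝔫) 𝔫 a t).mp hs
    have hz : IsLocalization.mk' ((T.St 0).presheaf.stalk (T.pt 0)) (eψ (C a)) ⟨eψ (C t), ht𝔮 t t.2⟩ ∈
        maximalIdeal _ :=
      (IsLocalization.AtPrime.mk'_mem_maximal_iff _ y₀.asIdeal (eψ (C a)) ⟨eψ (C t), ht𝔮 t t.2⟩).mpr ((hmem𝔫 a).mp ha)
    haveI := isLocalRing_range φ₀
    have hunitB : IsUnit (φ₀.rangeRestrict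
        (IsLocalization.mk' ((T.St 0).presheaf.stalk (T.pt 0)) (eψ (C a)) ⟨eψ (C t), ht𝔮 t t.2⟩)) := by
      refine IsUnit.of_mul_eq_one ⟨_, hrinv⟩ ?_
      apply Subtype.ext
      change φ₀ _ * _ = 1
      rw [hmk a t t.2]
      exact mul_inv_cancel₀ hr0
    rw [isUnit_rangeRestrict_iff] at hunitB
    exact (IsLocalRing.mem_maximalIdeal _ |>.mp hz) hunitB
  have hxB : (AdjoinRoot.root fK) ∈ φ₀.range := by
    refine ⟨algebraMap Γ(T.St 0, ⊤) _ (eψ X), ?_⟩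
    rw [hφ₀a, hψΓ, hψA, map_X, aeval_X]
  let Balg : Subalgebra R (AdjoinRoot fK) :=
    { toSubsemiring := φ₀.range.toSubsemiring
      algebraMap_mem' := fun r => hRB r.2 }
  have hBx : (Algebra.adjoin R ({AdjoinRoot.root fK} : Set (AdjoinRoot fK))).toSubring ≤ φ₀.range := by
    intro y hy
    have hle : Algebra.adjoin R ({AdjoinRoot.root fK} : Set (AdjoinRoot fK)) ≤ Balg :=
      Algebra.adjoin_le (Set.singleton_subset_iff.mpr hxB)
    exact hle hy
  have haevalmem : ∀ q : (Localization.AtPrime 𝔫)[X], aeval (AdjoinRoot.root fK) q ∈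
      (Algebra.adjoin R ({AdjoinRoot.root fK} : Set (AdjoinRoot fK))).toSubring := by
    intro q
    rw [Subalgebra.mem_toSubring, ← haeval q, Algebra.adjoin_singleton_eq_range_aeval]
    exact ⟨q.map f, rfl⟩
  have hfrac : ∀ w ∈ φ₀.range, ∃ y ∈ (Algebra.adjoin R ({AdjoinRoot.root fK} : Set (AdjoinRoot fK))).toSubring,
      ∃ z ∈ (Algebra.adjoin R ({AdjoinRoot.root fK} : Set (AdjoinRoot fK))).toSubring, z⁻¹ ∈ φ₀.range ∧ w = y / z := by
    rintro _ ⟨w, rfl⟩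
    obtain ⟨⟨u, v⟩, rfl⟩ := IsLocalization.mk'_surjective y₀.asIdeal.primeCompl w
    have hv0 : ψΓ v ≠ 0 := (hunit v).ne_zero
    have hval : φ₀ (IsLocalization.mk' _ u v) = ψΓ u / ψΓ v := by
      rw [eq_div_iff hv0]
      have := (IsLocalization.lift_mk'_spec (hg := hunit) u (φ₀ (IsLocalization.mk' _ u v)) v).mp rfl
      rw [this, mul_comm]
    have hinv1 : φ₀ (IsLocalization.mk' _ 1 v) = (ψΓ v)⁻¹ := by
      have := (IsLocalization.lift_mk'_spec (hg := hunit) (1 : Γ(T.St 0, ⊤)) (φ₀ (IsLocalization.mk' _ 1 v)) v).mp rfl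
      rw [map_one] at this
      exact eq_inv_of_mul_eq_one_right this.symm
    refine ⟨ψΓ u, ?_, ψΓ v, ?_, ⟨_, hinv1⟩, hval⟩
    · rw [← eψ.apply_symm_apply u, hψΓ, hψA]; exact haevalmem _
    · rw [← eψ.apply_symm_apply (v : Γ(T.St 0, ⊤)), hψΓ, hψA]; exact haevalmem _
  exact ⟨ZeroFrame.mk (AdjoinRoot fK) S₀ R hexcR hdimR hcharR h' (AdjoinRoot.root fK) hmon' hdeg' hx' hmin hgen' hcase'
    hRB hinv hBx hfrac⟩

end StageZeroFrame

end Summit.ResolutionOfSingularities.ResolutionOfSingularities.Theorems.ShallowPort
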